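import Literature.AlgebraicTopology.SingularHomology.Subdivision
import HarnessLib

/-!
# Cofaces, boundary and face retractions of the standard simplex

Topic `Literature/AlgebraicTopology/SingularHomology`. Elementary point-set bookkeeping on the
standard simplex `Δⁿ = Literature.AlgebraicTopology.SingularHomology.StdSimplex n`
(`= stdSimplex ℝ (Fin (n + 1))`, Mathlib) needed by the chain-level homotopy arguments of this
directory (`PrismChains.lean`, `SimplexBoxExtension.lean`, `HurewiczCompression.lean`), all
proved (A. Hatcher, *Algebraic Topology*, CUP 2002, §2.1, the faces `[v₀, …, v̂ᵢ, …, vₙ]` of a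
simplex and the boundary `∂Δⁿ`):

* `stdFace j : C(Δⁿ, Δⁿ⁺¹)` — the coface `δⱼ` (Mathlib's `stdSimplex.map (Fin.succAbove j)`, the
  map along which `SingularSimplex.face j` restricts: `SingularSimplex.toContinuousMap_face_apply`),
  its coordinates, injectivity, and `exists_stdFace_eq` (a point with `yⱼ = 0` is in the `j`-th face);
* `faceRetr j : C(Δⁿ⁺¹, Δⁿ)` — an affine left inverse of `δⱼ` (`faceRetr_stdFace`);
* `stdBoundary n ⊆ Δⁿ` — the boundary (some coordinate vanishes): closed, the union of the faces;
  `zeroIdx` picks a vanishing coordinate;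
* `stdFace_comp_stdFace` — the cosimplicial identity in the form "two codimension-two faces of
  `Δⁿ⁺²` through the same pair of deleted vertices coincide", with its consequences
  `eq_of_stdFace_stdFace_eq` and `SingularSimplex.face_face_eq`;
* `SingularSimplex.ofMap f` — a continuous map `Δⁿ → X` as a singular simplex, `ofMap_face`,
  `ofMap_map`.

## References

* A. Hatcher, *Algebraic Topology*, CUP 2002, §2.1. [HatcherAT2002]
-/

noncomputable section

open Set

universe u

namespace Literature.AlgebraicTopology.SingularHomology

variable {X Y : Type u} [TopologicalSpace X] [TopologicalSpace Y]

/-! ### Cofaces -/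

/-- The `j`-th coface `δⱼ : Δⁿ → Δⁿ⁺¹` of the standard simplex (insert a zero `j`-th barycentric
coordinate); this is Mathlib's `stdSimplex.map (Fin.succAbove j)`, the map along which
`SingularSimplex.face j` restricts (Hatcher 2002, §2.1). [folklore] -/
def stdFace {n : ℕ} (j : Fin (n + 2)) : C(StdSimplex n, StdSimplex (n + 1)) :=
  ⟨stdSimplex.map (Fin.succAbove j), stdSimplex.continuous_map _⟩

/-- `stdFace j` is `stdSimplex.map (Fin.succAbove j)` as a function. [folklore] -/
lemma stdFace_apply {n : ℕ} (j : Fin (n + 2)) (z : StdSimplex n) :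
    stdFace j z = stdSimplex.map (Fin.succAbove j) z := rfl

/-- Coordinates of `stdSimplex.map f z` along an injective `f`: the `f i`-th coordinate is `zᵢ`.
[folklore] -/
lemma stdSimplex_map_apply_of_injective {a b : ℕ} {f : Fin (a + 1) → Fin (b + 1)}
    (hf : Function.Injective f) (z : StdSimplex a) (i : Fin (a + 1)) :
    (stdSimplex.map f z : Fin (b + 1) → ℝ) (f i) = z i := by
  classical
  simp only [stdSimplex.map_coe]
  rw [FunOnFinite.linearMap_apply_apply]
  have h : (Finset.univ.filter fun x : Fin (a + 1) => f x = f i) = {i} := by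
    ext x
    simp [hf.eq_iff]
  rw [h, Finset.sum_singleton]

/-- Coordinates of `stdSimplex.map f z` off the range of `f` vanish. [folklore] -/
lemma stdSimplex_map_apply_of_not_mem_range {a b : ℕ} {f : Fin (a + 1) → Fin (b + 1)}
    (z : StdSimplex a) {k : Fin (b + 1)} (hk : k ∉ Set.range f) :
    (stdSimplex.map f z : Fin (b + 1) → ℝ) k = 0 := by
  classical
  simp only [stdSimplex.map_coe]
  rw [FunOnFinite.linearMap_apply_apply]
  refine Finset.sum_eq_zero fun i hi => ?_
  simp only [Finset.mem_filter] at hi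
  exact absurd ⟨i, hi.2⟩ hk

/-- `stdSimplex.map f` is injective for injective `f`. [folklore] -/
lemma stdSimplex_map_injective {a b : ℕ} {f : Fin (a + 1) → Fin (b + 1)}
    (hf : Function.Injective f) : Function.Injective (stdSimplex.map (S := ℝ) f) := by
  intro z z' h
  ext i
  have h' := congrArg (fun w : StdSimplex b => (w : Fin (b + 1) → ℝ) (f i)) h
  simp only [stdSimplex_map_apply_of_injective hf] at h'
  exact h'

/-- The `j`-th coordinate of `δⱼ z` vanishes. [folklore] -/
@[simp]
lemma stdFace_apply_self {n : ℕ} (j : Fin (n + 2)) (z : StdSimplex n) :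
    (stdFace j z : Fin (n + 2) → ℝ) j = 0 :=
  stdSimplex_map_apply_of_not_mem_range z (by simp [Fin.range_succAbove])

/-- The coordinates of `δⱼ z` off `j` are those of `z`. [folklore] -/
@[simp]
lemma stdFace_apply_succAbove {n : ℕ} (j : Fin (n + 2)) (z : StdSimplex n) (l : Fin (n + 1)) :
    (stdFace j z : Fin (n + 2) → ℝ) (j.succAbove l) = z l :=
  stdSimplex_map_apply_of_injective Fin.succAbove_right_injective z l

/-- `δⱼ` is injective. [folklore] -/
lemma stdFace_injective {n : ℕ} (j : Fin (n + 2)) : Function.Injective (stdFace (n := n) j) :=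
  stdSimplex_map_injective Fin.succAbove_right_injective

/-- A point of `Δⁿ⁺¹` with vanishing `j`-th coordinate is `δⱼ` of the point of `Δⁿ` obtained by
deleting that coordinate. [folklore] -/
lemma exists_stdFace_eq {n : ℕ} (j : Fin (n + 2)) (y : StdSimplex (n + 1))
    (hy : (y : Fin (n + 2) → ℝ) j = 0) : ∃ z : StdSimplex n, stdFace j z = y := by
  refine ⟨⟨fun l => y (j.succAbove l), fun l => y.2.1 _, ?_⟩, ?_⟩
  · have h := y.2.2
    rw [Fin.sum_univ_succAbove _ j] at h
    change y j + ∑ l : Fin (n + 1), y (j.succAbove l) = 1 at h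
    change (y : Fin (n + 2) → ℝ) j = 0 at hy
    linarith
  · ext i
    rcases Fin.eq_self_or_eq_succAbove j i with rfl | ⟨l, rfl⟩
    · rw [stdFace_apply_self]; exact hy.symm
    · rw [stdFace_apply_succAbove]; rfl

/-- Composition of cofaces is `stdSimplex.map` of the composite vertex map. [folklore] -/
lemma stdFace_comp_stdFace_apply {n : ℕ} (j : Fin (n + 3)) (l : Fin (n + 2)) (w : StdSimplex n) :
    stdFace j (stdFace l w) = stdSimplex.map (j.succAbove ∘ l.succAbove) w := by
  rw [stdFace_apply, stdFace_apply, stdSimplex.map_comp_apply]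

/-- The vertex maps of two codimension-two faces of `Δⁿ⁺²` deleting the same two vertices
`{j, j'}` coincide (the cosimplicial identity `δⱼ δₗ = δⱼ' δₗ'`): a strictly monotone map out of
a finite ordinal is determined by its range. [folklore] -/
lemma succAbove_comp_succAbove_eq {n : ℕ} {j j' : Fin (n + 3)} {l l' : Fin (n + 2)}
    (h1 : j.succAbove l = j') (h2 : j'.succAbove l' = j) :
    (j.succAbove ∘ l.succAbove : Fin (n + 1) → Fin (n + 3)) = j'.succAbove ∘ l'.succAbove := by
  have hr : ∀ {a a' : Fin (n + 3)} {b : Fin (n + 2)}, a.succAbove b = a' →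
      Set.range (a.succAbove ∘ b.succAbove) = ({a, a'}ᶜ : Set (Fin (n + 3))) := by
    intro a a' b hab
    rw [Set.range_comp, Fin.range_succAbove, ← hab]
    ext k
    simp only [Set.mem_image, Set.mem_compl_iff, Set.mem_singleton_iff, Set.mem_insert_iff,
      not_or]
    constructor
    · rintro ⟨c, hc, rfl⟩
      exact ⟨Fin.succAbove_ne a c, fun h => hc (Fin.succAbove_right_injective h)⟩
    · rintro ⟨hka, hkab⟩
      obtain ⟨c, rfl⟩ := Fin.exists_succAbove_eq hka
      exact ⟨c, fun h => hkab (by rw [h]), rfl⟩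
  rw [← (Fin.strictMono_succAbove j).comp (Fin.strictMono_succAbove l) |>.range_inj
    ((Fin.strictMono_succAbove j').comp (Fin.strictMono_succAbove l')), hr h1, hr h2,
    Set.pair_comm]

/-- Two codimension-two faces of `Δⁿ⁺²` deleting the same two vertices coincide as maps
`Δⁿ → Δⁿ⁺²`. [folklore] -/
lemma stdFace_comp_stdFace {n : ℕ} {j j' : Fin (n + 3)} {l l' : Fin (n + 2)}
    (h1 : j.succAbove l = j') (h2 : j'.succAbove l' = j) :
    (stdFace j).comp (stdFace l) = (stdFace (n := n + 1) j').comp (stdFace l') := by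
  ext w : 1
  change stdFace j (stdFace l w) = stdFace j' (stdFace l' w)
  rw [stdFace_comp_stdFace_apply, stdFace_comp_stdFace_apply, succAbove_comp_succAbove_eq h1 h2]

/-- A point of `Δⁿ⁺²` lying on two codimension-two faces through the same deleted vertices has the
same parameter on both. [folklore] -/
lemma eq_of_stdFace_stdFace_eq {n : ℕ} {j j' : Fin (n + 3)} {l l' : Fin (n + 2)}
    (h1 : j.succAbove l = j') (h2 : j'.succAbove l' = j) {w w' : StdSimplex n}
    (h : stdFace j (stdFace l w) = stdFace j' (stdFace l' w')) : w = w' := by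
  rw [stdFace_comp_stdFace_apply, stdFace_comp_stdFace_apply, succAbove_comp_succAbove_eq h1 h2]
    at h
  exact stdSimplex_map_injective ((Fin.succAbove_right_injective).comp
    Fin.succAbove_right_injective) h

/-! ### Face retractions -/

/-- An affine left inverse `Δⁿ⁺¹ → Δⁿ` of the coface `δⱼ`: delete the `j`-th coordinate and add
it to the `0`-th one (so that the result stays in the simplex). [folklore] -/
def faceRetr {n : ℕ} (j : Fin (n + 2)) : C(StdSimplex (n + 1), StdSimplex n) where
  toFun y := ⟨fun l => y (j.succAbove l) + if l = 0 then y j else 0, by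
    refine ⟨fun l => add_nonneg (y.2.1 _) ?_, ?_⟩
    · split_ifs
      · exact y.2.1 _
      · exact le_rfl
    · rw [Finset.sum_add_distrib, Finset.sum_ite_eq' Finset.univ (0 : Fin (n + 1))]
      simp only [Finset.mem_univ, if_true]
      have h := y.2.2
      rw [Fin.sum_univ_succAbove _ j] at h
      change y j + ∑ l : Fin (n + 1), y (j.succAbove l) = 1 at h
      linarith⟩
  continuous_toFun := by
    refine Continuous.subtype_mk (continuous_pi fun l => ?_) _
    refine Continuous.add ((continuous_apply _).comp continuous_subtype_val) ?_
    split_ifs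
    · exact (continuous_apply _).comp continuous_subtype_val
    · exact continuous_const

/-- `faceRetr j` is a left inverse of `δⱼ`. [folklore] -/
@[simp]
lemma faceRetr_stdFace {n : ℕ} (j : Fin (n + 2)) (w : StdSimplex n) : faceRetr j (stdFace j w) = w := by
  ext l
  change (stdFace j w : Fin (n + 2) → ℝ) (j.succAbove l) +
    (if l = 0 then (stdFace j w : Fin (n + 2) → ℝ) j else 0) = w l
  rw [stdFace_apply_succAbove, stdFace_apply_self, ite_self, add_zero]

/-! ### The boundary -/

/-- The boundary `∂Δⁿ ⊆ Δⁿ`: points with some vanishing barycentric coordinate (Hatcher 2002,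
§2.1). For `n = 0` it is empty. [folklore] -/
def stdBoundary (n : ℕ) : Set (StdSimplex n) := {y | ∃ i, (y : Fin (n + 1) → ℝ) i = 0}

/-- Membership in the boundary. [folklore] -/
lemma mem_stdBoundary_iff {n : ℕ} (y : StdSimplex n) :
    y ∈ stdBoundary n ↔ ∃ i, (y : Fin (n + 1) → ℝ) i = 0 := Iff.rfl

/-- The boundary is closed. [folklore] -/
lemma isClosed_stdBoundary (n : ℕ) : IsClosed (stdBoundary n) := by
  have h : stdBoundary n = ⋃ i : Fin (n + 1), {y : StdSimplex n | (y : Fin (n + 1) → ℝ) i = 0} := by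
    ext y; simp [stdBoundary]
  rw [h]
  exact isClosed_iUnion_of_finite fun i =>
    isClosed_eq ((continuous_apply i).comp continuous_subtype_val) continuous_const

/-- The faces lie in the boundary: `δⱼ z ∈ ∂Δⁿ⁺¹`. [folklore] -/
lemma stdFace_mem_stdBoundary {n : ℕ} (j : Fin (n + 2)) (z : StdSimplex n) :
    stdFace j z ∈ stdBoundary (n + 1) := ⟨j, stdFace_apply_self j z⟩

/-- The boundary of `Δⁿ⁺¹` is the union of the images of the cofaces. [folklore] -/
lemma stdBoundary_eq_iUnion_range (n : ℕ) :
    stdBoundary (n + 1) = ⋃ j : Fin (n + 2), Set.range (stdFace (n := n) j) := by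
  ext y
  simp only [Set.mem_iUnion, Set.mem_range]
  constructor
  · rintro ⟨j, hj⟩
    obtain ⟨z, hz⟩ := exists_stdFace_eq j y hj
    exact ⟨j, z, hz⟩
  · rintro ⟨j, z, rfl⟩
    exact stdFace_mem_stdBoundary j z

/-- The image of a coface is closed (compact). [folklore] -/
lemma isClosed_range_stdFace {n : ℕ} (j : Fin (n + 2)) : IsClosed (Set.range (stdFace (n := n) j)) :=
  (isCompact_range (stdFace j).continuous).isClosed

/-- The boundary of `Δ⁰` is empty (the only coordinate is `1`). [folklore] -/
lemma stdBoundary_zero : stdBoundary 0 = ∅ := by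
  ext y
  simp only [mem_stdBoundary_iff, Set.mem_empty_iff_false, iff_false, not_exists]
  intro i
  have h := y.2.2
  rw [Fin.sum_univ_one] at h
  rw [Fin.fin_one_eq_zero i]
  change (y : Fin 1 → ℝ) 0 ≠ 0
  rw [show (y : Fin 1 → ℝ) 0 = 1 from h]
  exact one_ne_zero

/-- Two distinct coordinates of a point of `Δ¹` cannot both vanish. [folklore] -/
lemma stdSimplex_one_ne {y : StdSimplex 1} {i i' : Fin 2} (hi : (y : Fin 2 → ℝ) i = 0)
    (hi' : (y : Fin 2 → ℝ) i' = 0) : i = i' := by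
  by_contra hne
  have h := y.2.2
  rw [Fin.sum_univ_two] at h
  change (y : Fin 2 → ℝ) 0 + (y : Fin 2 → ℝ) 1 = 1 at h
  rcases Fin.eq_zero_or_eq_succ i with rfl | ⟨k, rfl⟩ <;>
    rcases Fin.eq_zero_or_eq_succ i' with rfl | ⟨k', rfl⟩
  · exact hne rfl
  · rw [Subsingleton.elim k' 0] at hi'
    change (y : Fin 2 → ℝ) 1 = 0 at hi'
    linarith
  · rw [Subsingleton.elim k 0] at hi
    change (y : Fin 2 → ℝ) 1 = 0 at hi
    linarith
  · exact hne (by rw [Subsingleton.elim k k'])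

open Classical in
/-- A vanishing coordinate of a point of `Δⁿ⁺¹` (the index `0` off the boundary). [folklore] -/
def zeroIdx {n : ℕ} (y : StdSimplex (n + 1)) : Fin (n + 2) :=
  if h : ∃ i, (y : Fin (n + 2) → ℝ) i = 0 then h.choose else 0

/-- On the boundary, the chosen coordinate vanishes. [folklore] -/
lemma apply_zeroIdx {n : ℕ} {y : StdSimplex (n + 1)} (hy : y ∈ stdBoundary (n + 1)) :
    (y : Fin (n + 2) → ℝ) (zeroIdx y) = 0 := by
  have h : ∃ i, (y : Fin (n + 2) → ℝ) i = 0 := hy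
  rw [zeroIdx, dif_pos h]
  exact h.choose_spec

/-! ### Singular simplices of continuous maps -/

namespace SingularSimplex

/-- A continuous map `Δⁿ → X` regarded as a singular `n`-simplex (inverse of
`SingularSimplex.toContinuousMap`; Hatcher 2002, §2.1). [folklore] -/
def ofMap {n : ℕ} (f : C(StdSimplex n, X)) : SingularSimplex X n := toContinuousMap.symm f

/-- `toContinuousMap (ofMap f) = f`. [folklore] -/
@[simp]
lemma toContinuousMap_ofMap {n : ℕ} (f : C(StdSimplex n, X)) : toContinuousMap (ofMap f) = f :=
  Equiv.apply_symm_apply _ _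

/-- `ofMap (toContinuousMap ρ) = ρ`. [folklore] -/
@[simp]
lemma ofMap_toContinuousMap {n : ℕ} (ρ : SingularSimplex X n) : ofMap (toContinuousMap ρ) = ρ :=
  Equiv.symm_apply_apply _ _

/-- The faces of the simplex of a map are the simplices of its restrictions along the cofaces:
`(ofMap f).face j = ofMap (f ∘ δⱼ)` (Hatcher 2002, §2.1). [folklore] -/
lemma ofMap_face {n : ℕ} (f : C(StdSimplex (n + 1), X)) (j : Fin (n + 2)) :
    (ofMap f).face j = ofMap (f.comp (stdFace j)) := by
  apply toContinuousMap_injective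
  rw [toContinuousMap_face, toContinuousMap_ofMap, toContinuousMap_ofMap]
  rfl

/-- Push-forward of the simplex of a map: `(ofMap f).map g = ofMap (g ∘ f)`. [folklore] -/
lemma ofMap_map {n : ℕ} (f : C(StdSimplex n, X)) (g : C(X, Y)) :
    (ofMap f).map g = ofMap (g.comp f) := by
  apply toContinuousMap_injective
  rw [toContinuousMap_map, toContinuousMap_ofMap, toContinuousMap_ofMap]

/-- Pointwise form of `toContinuousMap_face`: `(ρ.face j)(z) = ρ(δⱼ z)`. [folklore] -/
lemma toContinuousMap_face_apply {n : ℕ} (j : Fin (n + 2)) (ρ : SingularSimplex X (n + 1))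
    (z : StdSimplex n) : toContinuousMap (ρ.face j) z = toContinuousMap ρ (stdFace j z) := rfl

/-- Two codimension-two faces of a singular simplex deleting the same two vertices coincide:
`(ρ.face j).face l = (ρ.face j').face l'` when `{j, δⱼ l} = {j', δⱼ' l'}` (the simplicial
identity `dₗ dⱼ = dₗ' dⱼ'`, Hatcher 2002, §2.1). [folklore] -/
lemma face_face_eq {n : ℕ} (ρ : SingularSimplex X (n + 2)) {j j' : Fin (n + 3)}
    {l l' : Fin (n + 2)} (h1 : j.succAbove l = j') (h2 : j'.succAbove l' = j) :
    (ρ.face j).face l = (ρ.face j').face l' := by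
  apply toContinuousMap_injective
  rw [toContinuousMap_face, toContinuousMap_face, toContinuousMap_face, toContinuousMap_face,
    ContinuousMap.comp_assoc, ContinuousMap.comp_assoc]
  exact congrArg (toContinuousMap ρ).comp (stdFace_comp_stdFace h1 h2)

end SingularSimplex

end Literature.AlgebraicTopology.SingularHomology
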